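/-
Copyright: the b2b-balaban cell (near-miss cell 7), T⁴-continuum fan-out; row NE7b ROUND-2 swarm, seat
t4-ne7b-formalise-leaf-05 (row S6e part 2 of `t4/b2b-balaban-t4-ne7b-p1/LEAVES-NE7b.md`).  Released under the licence of the
surrounding project.
-/
import Summits.QuantumFields.BalabanUV.T4Continuum.Support.HistoryShapeCrowd
import Summits.QuantumFields.BalabanUV.T4Continuum.Support.PartnerMultiplicityZ

/-!
# Row NE7b, leaf S6e part 2: the weighted crowding theorem for TAGGED genealogies with shape-generic births

Summits-side support leaf of the T⁴-continuum cell (rung (B)+1 on a FINITE torus only; NOT infinite volume, NOT the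
mass gap, NOT the Clay statement; NOT a proof of the spine estimate NE7b).  Row S6e of the owner's RULING R-OWNER-22-1/3
(the COUNT assembly targets the TH exit over TAGGED genealogies `G : Gen ε`, shape map `sh : ε → PEv`), repair (R-a) of
the cell's finding F-leaf05-2.  [folklore] finite combinatorics and real arithmetic over the lineage's OWN carrier — the
VERBATIM transport of `Crowding.merges_budget`, `CrowdingBudget.youngerRoot_budget` and `CrowdingWeighted.{card_merges_add_one,
sum_wcnt, crowdingW, crowdingW_linear, prod_rpow_Qw_le}` along a shape map (their generic core `CrowdingRoots` ∕
`CrowdingAnalysis*` ∕ `PlacementSkeleton` is used BY NAME); nothing is quoted from print, nothing printed is asserted,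
no `[cite:]` tag, no `def … : Prop` fact (c1); constants SYMBOLIC (c2∕c6).

WHY (finding F-leaf05-2 of the cell's records).  On tagged genealogies the class-linear crowding bound
`Σ_{mergers} p·log Q(wcntS, σ, step) ≤ θ·Σ_{births}((sh b).fat+1) + ε·partnerAges + crowdA·(…)` is FALSE when equal-shape
births crowd one step (m births of one shape joined at the next step cost `≳ p·m·log m` against a budget `O(m)`): the
flat proof pays the mergers at one step through their younger roots, whose `(age, class)` pairs are distinct ONLY because
distinct flat births have distinct shapes (`eq_of_kind_zero`).  THIS LEAF proves the tagged theorem under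
exactly that hypothesis — SHAPE-GENERIC BIRTHS `Set.InjOn sh ↑(births G)` (the owner's sub-class `TypeNodup` restricted
to births; merger and renewal labels stay free, so the thin menus and same-step joins are untouched) — which is what row
S6e's absorption of the (GM) zone multiplicity (row S6's `card_admZSet_le_of_readingS`, computed ON THE TAGGED TREE with
`HistoryZones.wcntS`) into the birth credits needs.

WHAT.  §1 `mergesAtS sh G t`, `card_mergesAtS_le_wcntS`, `one_le_QS_of_mem`, `card_merges_add_oneE` ∕
`card_merges_le_fatSumS` (any alphabet), `sum_wcntS`.  §2 `youngerRoot_budgetS` (mergers `Ms : Finset ε` at one step,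
assignment `y : ε → PEv` injective on `Ms`, kind `0`, step `≤ s + 1`).  §3 `merges_budgetS` (the matching
`CrowdingRoots.youngerRoot` read through `sh`; injective into the birth SHAPES by shape-genericity).  §4 **`crowdingWS`**,
`crowdingWS_linear`, **`prod_rpow_QwS_le`** and the zone form **`zone_surchargeS_le`**:
`Kz^{#merges G}·∏_{e ∈ merges G} Q(wcntS sh G, σ, (sh e).step)^p·Λ′^{partnerAges (step∘sh) G}`
`  ≤ exp(zoneRate Kz p σ ε θ·Σ_{b ∈ births G}((sh b).fat+1))·(Λ′e^{ε})^{partnerAges (step∘sh) G}`.  §5 sanity.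

HONEST.  The equal-shape sibling crowds (where `InjOn sh (births G)` fails) are NOT covered: they are the named residual of
F-leaf05-2 (repair (R-b), a symmetrised placement count, is the owner's to rule).  Nothing of H3 ∕ (B) ∕ BetaPertH.
NE7b NOT proved.  HONEST DEPENDENCY (cell): continuum YM on T⁴ ⇐ BetaPertH ∧ nine spine estimates (0/9 proved); BetaPertH ⇐
(D1) ∧ (D4) ∧ CAP+tail; G-an2-4 gates asym, D1 and NE2/3/4.  This file changes none of it.
-/

open Finset
open Literature.MathematicalPhysics.QuantumFieldTheory.Balaban1983to89
open T4PersistenceDictionary T4PartnerMultiplicity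
open Summit.QuantumFields.BalabanUV.T4Continuum
open PlacementSkeleton PlacementBatch Crowding PartnerMultiplicityZ HistoryZones

namespace Summit.QuantumFields.BalabanUV.T4Continuum.HistoryCrowdingTagged

noncomputable section

variable {ε : Type*} [DecidableEq ε] (sh : ε → PEv) (W : ε → ℕ)

/-! ## §1 Mergers at a shape-step, the weighted count, the births∕mergers balance -/

/-- the mergers of `G` whose SHAPE is dated `t` [folklore] -/
def mergesAtS (G : Gen ε) (t : ℕ) : Finset ε := (merges G).filter fun e => (sh e).step = t

omit [DecidableEq ε] in
/-- `m_t ≤ wcntS G t` [folklore] -/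
theorem card_mergesAtS_le_wcntS [DecidableEq ε] (G : Gen ε) (t : ℕ) : (mergesAtS sh G t).card ≤ wcntS sh G t :=
  Nat.le_add_left _ _

variable {sh}

/-- a merger is counted at its own shape-step: `1 ≤ wcntS G (step (sh e))` [folklore] -/
theorem one_le_wcntS_of_mem {G : Gen ε} {e : ε} (he : e ∈ merges G) : 1 ≤ wcntS sh G (sh e).step :=
  have h1 : 1 ≤ (mergesAtS sh G (sh e).step).card := card_pos.2 ⟨e, mem_filter.2 ⟨he, rfl⟩⟩
  le_trans h1 (card_mergesAtS_le_wcntS sh G _)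

/-- hence `1 ≤ Q(wcntS G, σ, step (sh e))` at every merger [folklore] -/
theorem one_le_QS_of_mem {G : Gen ε} {σ : ℝ} (hσ : 0 ≤ σ) {e : ε} (he : e ∈ merges G) :
    1 ≤ Q (wcntS sh G) σ (sh e).step :=
  le_trans (by exact_mod_cast one_le_wcntS_of_mem he) (self_le_Q (wcntS sh G) hσ _)

variable {W}

/-- **BIRTHS AND MERGERS BALANCE** (any alphabet): a well-formed genealogy has exactly one more birth than mergers.
[folklore] -/
theorem card_merges_add_oneE : ∀ {G : Gen ε}, G.WF W → (merges G).card + 1 = (births G).card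
  | Gen.born b j, _ => by simp [merges]
  | Gen.renew G e h, hW => by simpa [merges] using card_merges_add_oneE (G := G) hW.1
  | Gen.merge X Y e, hW => by
      obtain ⟨heX, heY, hdM, hdB⟩ := merge_facts W hW
      have hXY : e ∉ merges X ∪ merges Y := by simp [heX, heY]
      rw [merges, births_merge, card_insert_of_notMem hXY, card_union_of_disjoint hdM, card_union_of_disjoint hdB,
        ← card_merges_add_oneE hW.1, ← card_merges_add_oneE hW.2.1]
      ring

/-- `#merges G ≤ Σ_{births} ((sh b).fat + 1)` for a well-formed tagged genealogy [folklore] -/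
theorem card_merges_le_fatSumS {G : Gen ε} (hW : G.WF W) :
    ((merges G).card : ℝ) ≤ ∑ b ∈ births G, ((((sh b).fat : ℕ) : ℝ) + 1) := by
  have h1 : ((merges G).card : ℝ) ≤ (births G).card := by
    exact_mod_cast (Nat.le_succ _).trans (card_merges_add_oneE hW).le
  have h2 : ((births G).card : ℝ) ≤ ∑ b ∈ births G, ((((sh b).fat : ℕ) : ℝ) + 1) := by
    have : ∑ b ∈ births G, (1 : ℝ) ≤ ∑ b ∈ births G, ((((sh b).fat : ℕ) : ℝ) + 1) :=
      sum_le_sum fun b _ => le_add_of_nonneg_left (Nat.cast_nonneg _)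
    simpa using this
  exact h1.trans h2

variable (sh) in
/-- `Σ_{t ≤ T} wcntS G t = Σ_{births} ((sh b).fat + 1) + #merges G` once every formation shape is dated `≤ T`. [folklore] -/
theorem sum_wcntS {G : Gen ε} {T : ℕ} (hTb : ∀ b ∈ births G, (sh b).step ∈ range (T + 1))
    (hTm : ∀ e ∈ merges G, (sh e).step ∈ range (T + 1)) :
    ∑ t ∈ range (T + 1), (wcntS sh G t : ℝ) = ∑ b ∈ births G, ((((sh b).fat : ℕ) : ℝ) + 1) + (merges G).card := by
  have hb : ∑ t ∈ range (T + 1), ∑ b ∈ (births G).filter (fun b => (sh b).step = t), ((((sh b).fat : ℕ) : ℝ) + 1) =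
      ∑ b ∈ births G, ((((sh b).fat : ℕ) : ℝ) + 1) := sum_fiberwise_of_maps_to hTb _
  have hm : ∑ t ∈ range (T + 1), (((merges G).filter fun m => (sh m).step = t).card : ℝ) = (merges G).card := by
    rw [card_eq_sum_card_fiberwise hTm, Nat.cast_sum]
  rw [← hb, ← hm, ← sum_add_distrib]
  refine sum_congr rfl fun t _ => ?_
  rw [wcntS]
  push_cast
  rfl

/-! ## §2 The younger-root budget along a shape assignment -/

/-- The pair `(age, class)` read off the assigned birth SHAPE `y e` of a merger at step `s`. [folklore] -/
def agePairS (s : ℕ) (y : ε → PEv) (e : ε) : ℕ × ℕ := (s + 1 - (y e).step, (y e).fat)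

omit [DecidableEq ε] in
/-- with an injective shape assignment of births with `step ≤ s + 1`, the `(age, class)` pairs of the mergers at step `s`
are pairwise distinct [folklore] -/
theorem injOn_agePairS (s : ℕ) (Ms : Finset ε) (y : ε → PEv) (hy : Set.InjOn y ↑Ms)
    (hkind : ∀ e ∈ Ms, (y e).kind = 0) (hstep : ∀ e ∈ Ms, (y e).step ≤ s + 1) :
    Set.InjOn (agePairS s y) ↑Ms := by
  intro e he e' he' h
  rw [mem_coe] at he he'
  simp only [agePairS, Prod.mk.injEq] at h
  have hs : (y e).step = (y e').step := by
    have h1 := hstep e he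
    have h2 := hstep e' he'
    omega
  exact hy (mem_coe.2 he) (mem_coe.2 he') (eq_of_kind_zero (hkind e he) (hkind e' he') hs h.2)

omit [DecidableEq ε] in
/-- **YOUNGER-ROOT BUDGET ALONG A SHAPE ASSIGNMENT.**  Mergers `Ms` at step `s` with an injective SHAPE assignment `y` of
births with `step (y e) ≤ s + 1`: `min(ε, θ∕2)·#Ms·√#Ms∕(2√2) ≤ Σ_{e ∈ Ms} (ε·(s + 1 − step (y e)) + (θ∕2)·(fat (y e) + 1))`.
[folklore] -/
theorem youngerRoot_budgetS {ε' θ : ℝ} (hε : 0 ≤ ε') (hθ : 0 ≤ θ) (s : ℕ) (Ms : Finset ε) (y : ε → PEv)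
    (hy : Set.InjOn y ↑Ms) (hkind : ∀ e ∈ Ms, (y e).kind = 0) (hstep : ∀ e ∈ Ms, (y e).step ≤ s + 1) :
    min ε' (θ / 2) * ((Ms.card : ℝ) * Real.sqrt Ms.card / (2 * Real.sqrt 2)) ≤
      ∑ e ∈ Ms, (ε' * ((s + 1 - (y e).step : ℕ) : ℝ) + θ / 2 * ((y e).fat + 1)) := by
  classical
  have hinj := injOn_agePairS s Ms y hy hkind hstep
  set T := Ms.image (agePairS s y) with hT
  have hcard : T.card = Ms.card := card_image_of_injOn hinj
  have h1 := card_mul_sqrt_le_sum T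
  rw [hcard] at h1
  have h2 : ∑ x ∈ T, ((x.1 + x.2 + 1 : ℕ) : ℝ) = ∑ e ∈ Ms, (((s + 1 - (y e).step) + (y e).fat + 1 : ℕ) : ℝ) := by
    rw [hT, sum_image fun _ hx _ hx' h => hinj hx hx' h]
    rfl
  have hμ : 0 ≤ min ε' (θ / 2) := le_min hε (by linarith)
  calc min ε' (θ / 2) * ((Ms.card : ℝ) * Real.sqrt Ms.card / (2 * Real.sqrt 2))
      ≤ min ε' (θ / 2) * ∑ e ∈ Ms, (((s + 1 - (y e).step) + (y e).fat + 1 : ℕ) : ℝ) := by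
        rw [← h2]; exact mul_le_mul_of_nonneg_left h1 hμ
    _ = ∑ e ∈ Ms, min ε' (θ / 2) * (((s + 1 - (y e).step) + (y e).fat + 1 : ℕ) : ℝ) := by rw [mul_sum]
    _ ≤ ∑ e ∈ Ms, (ε' * ((s + 1 - (y e).step : ℕ) : ℝ) + θ / 2 * ((y e).fat + 1)) := sum_le_sum fun e _ => by
        have ha : (0 : ℝ) ≤ ((s + 1 - (y e).step : ℕ) : ℝ) := Nat.cast_nonneg _
        have hf : (0 : ℝ) ≤ ((y e).fat : ℝ) + 1 := by positivity
        have hm1 : min ε' (θ / 2) ≤ ε' := min_le_left _ _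
        have hm2 : min ε' (θ / 2) ≤ θ / 2 := min_le_right _ _
        push_cast
        nlinarith

/-! ## §3 The mergers' budget: the younger roots read through the shape map -/

/-- **MERGERS.**  For a well-formed tagged genealogy with step data `StepsOK (step ∘ sh)`, ordered mergers, kind-`0` birth
shapes and SHAPE-GENERIC BIRTHS `InjOn sh (births G)`, once all merger shapes are dated `≤ T`:
`Σ_{t ≤ T} min(ε,θ∕2)·m_t√m_t∕(2√2) ≤ (θ∕2)·Σ_{b ∈ births G}((sh b).fat + 1) + ε·partnerAges (step ∘ sh) G`. [folklore] -/
theorem merges_budgetS {ε' θ : ℝ} (hε : 0 ≤ ε') (hθ : 0 ≤ θ) {G : Gen ε} (hW : G.WF W)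
    (hS : StepsOK (PEv.step ∘ sh) G) (hO : Ordered (PEv.step ∘ sh) G) (hk : ∀ b ∈ births G, (sh b).kind = 0)
    (hinjB : Set.InjOn sh ↑(births G)) {T : ℕ} (hT : ∀ e ∈ merges G, (sh e).step ∈ range (T + 1)) :
    ∑ t ∈ range (T + 1), min ε' (θ / 2) * (((mergesAtS sh G t).card : ℝ) * Real.sqrt (mergesAtS sh G t).card /
        (2 * Real.sqrt 2)) ≤
      θ / 2 * ∑ b ∈ births G, ((((sh b).fat : ℕ) : ℝ) + 1) + ε' * (partnerAges (PEv.step ∘ sh) G : ℝ) := by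
  -- per step: the younger-root budget along `sh ∘ youngerRoot G`
  have hyinj : Set.InjOn (sh ∘ youngerRoot G) ↑(merges G) := by
    intro a ha b hb h
    have ha' := (youngerRoot_mem_births W hW a ha).1
    have hb' := (youngerRoot_mem_births W hW b hb).1
    exact youngerRoot_injOn W hW ha hb (hinjB ha' hb' h)
  have h1 : ∀ t ∈ range (T + 1),
      min ε' (θ / 2) * (((mergesAtS sh G t).card : ℝ) * Real.sqrt (mergesAtS sh G t).card / (2 * Real.sqrt 2)) ≤
        ∑ e ∈ mergesAtS sh G t, (ε' * ((t + 1 - (sh (youngerRoot G e)).step : ℕ) : ℝ) +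
          θ / 2 * (((sh (youngerRoot G e)).fat : ℝ) + 1)) := by
    intro t _
    refine youngerRoot_budgetS hε hθ t (mergesAtS sh G t) (sh ∘ youngerRoot G) ?_ ?_ ?_
    · exact hyinj.mono (coe_subset.2 (filter_subset _ _))
    · intro e he
      exact hk _ (youngerRoot_mem_births W hW e (mem_filter.1 he).1).1
    · intro e he
      obtain ⟨he', hst⟩ := mem_filter.1 he
      have h := st_youngerRoot_le W (PEv.step ∘ sh) hW hS hO e he'
      simp only [Function.comp_apply] at h
      rwa [hst] at h
  -- regroup the fibres into one sum over the mergers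
  have h2 : ∑ t ∈ range (T + 1), ∑ e ∈ mergesAtS sh G t, (ε' * ((t + 1 - (sh (youngerRoot G e)).step : ℕ) : ℝ) +
        θ / 2 * (((sh (youngerRoot G e)).fat : ℝ) + 1)) =
      ∑ e ∈ merges G, (ε' * (((sh e).step + 1 - (sh (youngerRoot G e)).step : ℕ) : ℝ) +
        θ / 2 * (((sh (youngerRoot G e)).fat : ℝ) + 1)) := by
    rw [← sum_fiberwise_of_maps_to hT]
    refine sum_congr rfl fun t _ => sum_congr rfl fun e he => ?_
    rw [(mem_filter.1 he).2]
  -- the ages sum to `partnerAges`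
  have h3 : ∑ e ∈ merges G, ε' * (((sh e).step + 1 - (sh (youngerRoot G e)).step : ℕ) : ℝ) =
      ε' * (partnerAges (PEv.step ∘ sh) G : ℝ) := by
    rw [← mul_sum, ← Nat.cast_sum, ← sum_age_youngerRoot W (PEv.step ∘ sh) hW hS]
    rfl
  -- the classes are dominated by the births' (injectivity of the matching into the births; no genericity needed)
  have h4 : ∑ e ∈ merges G, θ / 2 * (((sh (youngerRoot G e)).fat : ℝ) + 1) ≤
      θ / 2 * ∑ b ∈ births G, ((((sh b).fat : ℕ) : ℝ) + 1) := by
    rw [← mul_sum]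
    refine mul_le_mul_of_nonneg_left ?_ (by linarith)
    have hinj := youngerRoot_injOn W hW (G := G)
    calc ∑ e ∈ merges G, (((sh (youngerRoot G e)).fat : ℝ) + 1)
        = ∑ b ∈ (merges G).image (youngerRoot G), ((((sh b).fat : ℕ) : ℝ) + 1) :=
          (sum_image (f := fun b : ε => ((((sh b).fat : ℕ) : ℝ) + 1)) fun _ hx _ hx' h => hinj hx hx' h).symm
      _ ≤ ∑ b ∈ births G, ((((sh b).fat : ℕ) : ℝ) + 1) :=
          sum_le_sum_of_subset_of_nonneg
            (image_subset_iff.2 fun e he => (youngerRoot_mem_births W hW e he).1)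
            fun _ _ _ => by positivity
  calc ∑ t ∈ range (T + 1), min ε' (θ / 2) * (((mergesAtS sh G t).card : ℝ) * Real.sqrt (mergesAtS sh G t).card /
        (2 * Real.sqrt 2))
      ≤ ∑ t ∈ range (T + 1), ∑ e ∈ mergesAtS sh G t, (ε' * ((t + 1 - (sh (youngerRoot G e)).step : ℕ) : ℝ) +
          θ / 2 * (((sh (youngerRoot G e)).fat : ℝ) + 1)) := sum_le_sum h1
    _ = ∑ e ∈ merges G, ε' * (((sh e).step + 1 - (sh (youngerRoot G e)).step : ℕ) : ℝ) +
          ∑ e ∈ merges G, θ / 2 * (((sh (youngerRoot G e)).fat : ℝ) + 1) := by rw [h2, sum_add_distrib]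
    _ ≤ θ / 2 * ∑ b ∈ births G, ((((sh b).fat : ℕ) : ℝ) + 1) + ε' * (partnerAges (PEv.step ∘ sh) G : ℝ) := by
          rw [h3]; linarith

/-! ## §4 The weighted crowding theorem along a shape map, and the zone surcharge -/

variable (sh) in
/-- the HORIZON of the formation shapes [folklore] -/
def horizonS (G : Gen ε) : ℕ := (births G ∪ merges G).sup (PEv.step ∘ sh)

variable (sh) in
/-- every formation shape is dated by the horizon [folklore] -/
theorem step_mem_rangeS {G : Gen ε} {e : ε} (he : e ∈ births G ∪ merges G) :
    (sh e).step ∈ range (horizonS sh G + 1) :=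
  mem_range.2 (Nat.lt_succ_of_le (le_sup (f := PEv.step ∘ sh) he))

/-- **THE WEIGHTED CROWDING THEOREM ALONG A SHAPE MAP.**  For a well-formed tagged genealogy with step data, ordered
mergers, kind-`0` birth shapes and SHAPE-GENERIC BIRTHS, for every `p ≥ 0`, `σ ∈ (0,1)`, `ε > 0`, `θ > 0`:
`Σ_{e ∈ merges G} p·log Q(wcntS G, σ, step (sh e)) ≤ θ·F + ε·partnerAges + crowdA p σ (min(ε,θ)∕8)·(F + #merges G)`,
`F = Σ_{b ∈ births G}((sh b).fat + 1)`. [folklore] -/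
theorem crowdingWS {p σ ε' θ : ℝ} (hp : 0 ≤ p) (h0 : 0 < σ) (h1 : σ < 1) (hε : 0 < ε') (hθ : 0 < θ)
    {G : Gen ε} (hW : G.WF W) (hS : StepsOK (PEv.step ∘ sh) G) (hO : Ordered (PEv.step ∘ sh) G)
    (hk : ∀ b ∈ births G, (sh b).kind = 0) (hinjB : Set.InjOn sh ↑(births G)) :
    ∑ e ∈ merges G, p * Real.log (Q (wcntS sh G) σ (sh e).step) ≤
      θ * ∑ b ∈ births G, ((((sh b).fat : ℕ) : ℝ) + 1) + ε' * (partnerAges (PEv.step ∘ sh) G : ℝ) +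
        crowdA p σ (min ε' θ / 8) * (∑ b ∈ births G, ((((sh b).fat : ℕ) : ℝ) + 1) + (merges G).card) := by
  set T := horizonS sh G with hTdef
  have hμ₀ : 0 < min ε' θ := lt_min hε hθ
  have hη : 0 < min ε' θ / 8 := by positivity
  have hTb : ∀ b ∈ births G, (sh b).step ∈ range (T + 1) := fun b hb => step_mem_rangeS sh (mem_union_left _ hb)
  have hTm : ∀ e ∈ merges G, (sh e).step ∈ range (T + 1) := fun e he => step_mem_rangeS sh (mem_union_right _ he)
  -- (i) regroup the cost by shape-steps (an identity)
  have hi : ∑ e ∈ merges G, p * Real.log (Q (wcntS sh G) σ (sh e).step) =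
      ∑ t ∈ range (T + 1), p * ((mergesAtS sh G t).card : ℕ) * Real.log (Q (wcntS sh G) σ t) := by
    rw [← sum_fiberwise_of_maps_to hTm]
    refine sum_congr rfl fun t _ => ?_
    rw [sum_congr rfl fun e he => by rw [(mem_filter.1 he).2], sum_const, nsmul_eq_mul, mergesAtS]
    ring
  -- (ii) the two-sequence analysis
  have hii := cost_le₂ hp h0 h1 hη (fun t => (mergesAtS sh G t).card) (wcntS sh G) (card_mergesAtS_le_wcntS sh G) T
  -- (iii) the merger budget at class rate `2θ`
  have hM := merges_budgetS (ε' := ε') hε.le (by positivity : (0 : ℝ) ≤ 2 * θ) hW hS hO hk hinjB hTm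
  have e2 : 2 * θ / 2 = θ := by ring
  rw [e2] at hM
  have hiii : 2 * (min ε' θ / 8) * ∑ t ∈ range (T + 1), ((mergesAtS sh G t).card : ℝ) *
        Real.sqrt (mergesAtS sh G t).card ≤
      θ * ∑ b ∈ births G, ((((sh b).fat : ℕ) : ℝ) + 1) + ε' * (partnerAges (PEv.step ∘ sh) G : ℝ) := by
    refine le_trans ?_ hM
    rw [mul_sum]
    refine sum_le_sum fun t _ => ?_
    set x := ((mergesAtS sh G t).card : ℝ) * Real.sqrt (mergesAtS sh G t).card with hx
    have hx0 : 0 ≤ x := by positivity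
    have hs2 : Real.sqrt 2 ≤ 2 := by
      nlinarith [Real.sq_sqrt (show (0 : ℝ) ≤ 2 by norm_num), Real.sqrt_nonneg 2]
    have hdiv : x / 4 ≤ x / (2 * Real.sqrt 2) :=
      div_le_div_of_nonneg_left hx0 (by positivity) (by linarith)
    have hmin : 0 ≤ min ε' θ := hμ₀.le
    calc 2 * (min ε' θ / 8) * x = min ε' θ * (x / 4) := by ring
      _ ≤ min ε' θ * (x / (2 * Real.sqrt 2)) := mul_le_mul_of_nonneg_left hdiv hmin
  -- (iv) the weighted total
  have hiv := sum_wcntS sh hTb hTm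
  rw [hi]
  calc ∑ t ∈ range (T + 1), p * ((mergesAtS sh G t).card : ℕ) * Real.log (Q (wcntS sh G) σ t)
      ≤ 2 * (min ε' θ / 8) * ∑ t ∈ range (T + 1), ((mergesAtS sh G t).card : ℝ) * Real.sqrt (mergesAtS sh G t).card +
          crowdA p σ (min ε' θ / 8) * ∑ t ∈ range (T + 1), (wcntS sh G t : ℝ) := hii
    _ ≤ θ * ∑ b ∈ births G, ((((sh b).fat : ℕ) : ℝ) + 1) + ε' * (partnerAges (PEv.step ∘ sh) G : ℝ) +
          crowdA p σ (min ε' θ / 8) * (∑ b ∈ births G, ((((sh b).fat : ℕ) : ℝ) + 1) + (merges G).card) := by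
        rw [← hiv]; linarith [hiii]

/-- **CLASS-LINEAR FORM.** [folklore] -/
theorem crowdingWS_linear {p σ ε' θ : ℝ} (hp : 0 ≤ p) (h0 : 0 < σ) (h1 : σ < 1) (hε : 0 < ε') (hθ : 0 < θ)
    {G : Gen ε} (hW : G.WF W) (hS : StepsOK (PEv.step ∘ sh) G) (hO : Ordered (PEv.step ∘ sh) G)
    (hk : ∀ b ∈ births G, (sh b).kind = 0) (hinjB : Set.InjOn sh ↑(births G)) :
    ∑ e ∈ merges G, p * Real.log (Q (wcntS sh G) σ (sh e).step) ≤
      (θ + 2 * crowdA p σ (min ε' θ / 8)) * ∑ b ∈ births G, ((((sh b).fat : ℕ) : ℝ) + 1) +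
        ε' * (partnerAges (PEv.step ∘ sh) G : ℝ) := by
  have h := crowdingWS hp h0 h1 hε hθ hW hS hO hk hinjB
  have hA := crowdA_nonneg hp h0 h1 (min ε' θ / 8)
  have hm := card_merges_le_fatSumS (sh := sh) hW
  nlinarith [mul_le_mul_of_nonneg_left hm hA]

/-- **PRODUCT FORM**: `∏_{e ∈ merges G} Q(wcntS G, σ, step (sh e))^p ≤ exp((θ + 2·crowdA)·F)·(exp ε)^{partnerAges}`.
[folklore] -/
theorem prod_rpow_QwS_le {p σ ε' θ : ℝ} (hp : 0 ≤ p) (h0 : 0 < σ) (h1 : σ < 1) (hε : 0 < ε') (hθ : 0 < θ)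
    {G : Gen ε} (hW : G.WF W) (hS : StepsOK (PEv.step ∘ sh) G) (hO : Ordered (PEv.step ∘ sh) G)
    (hk : ∀ b ∈ births G, (sh b).kind = 0) (hinjB : Set.InjOn sh ↑(births G)) :
    ∏ e ∈ merges G, Q (wcntS sh G) σ (sh e).step ^ p ≤
      Real.exp ((θ + 2 * crowdA p σ (min ε' θ / 8)) * ∑ b ∈ births G, ((((sh b).fat : ℕ) : ℝ) + 1)) *
        Real.exp ε' ^ partnerAges (PEv.step ∘ sh) G := by
  have hpos : ∀ e ∈ merges G, 0 < Q (wcntS sh G) σ (sh e).step :=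
    fun e he => lt_of_lt_of_le zero_lt_one (one_le_QS_of_mem h0.le he)
  have hpos' : ∀ e ∈ merges G, 0 < Q (wcntS sh G) σ (sh e).step ^ p := fun e he => Real.rpow_pos_of_pos (hpos e he) p
  rw [← Real.exp_nat_mul, ← Real.exp_add, ← Real.exp_log (prod_pos hpos'), Real.exp_le_exp,
    Real.log_prod (hf := fun e he => (hpos' e he).ne')]
  calc ∑ e ∈ merges G, Real.log (Q (wcntS sh G) σ (sh e).step ^ p)
      = ∑ e ∈ merges G, p * Real.log (Q (wcntS sh G) σ (sh e).step) :=
        sum_congr rfl fun e he => Real.log_rpow (hpos e he) p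
    _ ≤ (θ + 2 * crowdA p σ (min ε' θ / 8)) * ∑ b ∈ births G, ((((sh b).fat : ℕ) : ℝ) + 1) +
          ε' * (partnerAges (PEv.step ∘ sh) G : ℝ) := crowdingWS_linear hp h0 h1 hε hθ hW hS hO hk hinjB
    _ = (θ + 2 * crowdA p σ (min ε' θ / 8)) * ∑ b ∈ births G, ((((sh b).fat : ℕ) : ℝ) + 1) +
          (partnerAges (PEv.step ∘ sh) G : ℕ) * ε' := by ring

/-- **THE ZONE SURCHARGE OF A TAGGED GENEALOGY IS CLASS-LINEAR (shape-generic births).**  For `Kz ≥ 1`, `p ≥ 0`,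
`σ ∈ (0,1)`, `ε, θ > 0`, `Λ′ ≥ 0`:
`Kz^{#merges G}·∏_{mergers} Q(wcntS G, σ, step (sh e))^p·Λ′^{partnerAges (step∘sh) G}`
`  ≤ exp(zoneRate Kz p σ ε θ·Σ_{births}((sh b).fat+1))·(Λ′e^{ε})^{partnerAges (step∘sh) G}`. [folklore] -/
theorem zone_surchargeS_le {Kz p σ ε' θ Λ' : ℝ} (hKz : 1 ≤ Kz) (hp : 0 ≤ p) (h0 : 0 < σ) (h1 : σ < 1) (hε : 0 < ε')
    (hθ : 0 < θ) (hΛ : 0 ≤ Λ') {G : Gen ε} (hW : G.WF W) (hS : StepsOK (PEv.step ∘ sh) G)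
    (hO : Ordered (PEv.step ∘ sh) G) (hk : ∀ b ∈ births G, (sh b).kind = 0) (hinjB : Set.InjOn sh ↑(births G)) :
    Kz ^ (merges G).card * (∏ e ∈ merges G, Q (wcntS sh G) σ (sh e).step ^ p) *
        Λ' ^ partnerAges (PEv.step ∘ sh) G ≤
      Real.exp (zoneRate Kz p σ ε' θ * ∑ b ∈ births G, ((((sh b).fat : ℕ) : ℝ) + 1)) *
        (Λ' * Real.exp ε') ^ partnerAges (PEv.step ∘ sh) G := by
  set F := ∑ b ∈ births G, ((((sh b).fat : ℕ) : ℝ) + 1) with hF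
  have hF0 : 0 ≤ F := sum_nonneg fun _ _ => by positivity
  have hcrowd := prod_rpow_QwS_le hp h0 h1 hε hθ hW hS hO hk hinjB
  have hm : ((merges G).card : ℝ) ≤ F := card_merges_le_fatSumS (sh := sh) hW
  have hlog : 0 ≤ Real.log Kz := Real.log_nonneg hKz
  have hK0 : 0 < Kz := lt_of_lt_of_le zero_lt_one hKz
  have hKm : Kz ^ (merges G).card ≤ Real.exp (Real.log Kz * F) := by
    rw [← Real.rpow_natCast, Real.rpow_def_of_pos hK0]
    exact Real.exp_le_exp.2 (by nlinarith)
  have hP : 0 ≤ ∏ e ∈ merges G, Q (wcntS sh G) σ (sh e).step ^ p :=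
    prod_nonneg fun e he => (Real.rpow_pos_of_pos (lt_of_lt_of_le zero_lt_one (one_le_QS_of_mem h0.le he)) p).le
  have hΛp : 0 ≤ Λ' ^ partnerAges (PEv.step ∘ sh) G := pow_nonneg hΛ _
  calc Kz ^ (merges G).card * (∏ e ∈ merges G, Q (wcntS sh G) σ (sh e).step ^ p) * Λ' ^ partnerAges (PEv.step ∘ sh) G
      ≤ Real.exp (Real.log Kz * F) * (Real.exp ((θ + 2 * crowdA p σ (min ε' θ / 8)) * F) *
          Real.exp ε' ^ partnerAges (PEv.step ∘ sh) G) * Λ' ^ partnerAges (PEv.step ∘ sh) G :=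
        mul_le_mul_of_nonneg_right (mul_le_mul hKm hcrowd hP (Real.exp_pos _).le) hΛp
    _ = Real.exp (zoneRate Kz p σ ε' θ * F) * (Λ' * Real.exp ε') ^ partnerAges (PEv.step ∘ sh) G := by
        rw [zoneRate]; simp only [add_mul, Real.exp_add, mul_pow]; ring

/-! ## §5 Sanity -/

namespace Sanity

/-- the counterexample shape of F-leaf05-2 is excluded by the hypothesis: two tagged births with ONE shape are not
shape-generic (decided) -/
example : ¬ Set.InjOn (Prod.fst : PEv × ℕ → PEv)
    ↑(births (Gen.merge (Gen.born (((0, 0, 0) : PEv), 1) 0) (Gen.born (((0, 0, 0) : PEv), 2) 0) (((1, 2, 0) : PEv), 3))) := by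
  intro h
  have h1 : (((0, 0, 0) : PEv), 1) ∈
      (↑(births (Gen.merge (Gen.born (((0, 0, 0) : PEv), 1) 0) (Gen.born (((0, 0, 0) : PEv), 2) 0)
        (((1, 2, 0) : PEv), 3))) : Set (PEv × ℕ)) := by simp
  have h2 : (((0, 0, 0) : PEv), 2) ∈
      (↑(births (Gen.merge (Gen.born (((0, 0, 0) : PEv), 1) 0) (Gen.born (((0, 0, 0) : PEv), 2) 0)
        (((1, 2, 0) : PEv), 3))) : Set (PEv × ℕ)) := by simp
  have := h h1 h2 rfl
  simp at this

end Sanity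

end

end Summit.QuantumFields.BalabanUV.T4Continuum.HistoryCrowdingTagged
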